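import Mathlib
import Literature.NumberTheory.Irrationality.Fischler2002.FamilyJ
import Literature.NumberTheory.Irrationality.Fischler2002.JnFinitenessCriterionProofs
import HarnessLib

/-!
# Fischler's finiteness criterion for `𝒥(p)` — V: the case `n = 5` of `FamilyJ.lean` (`integralJ_finite_iff`)

Topic `Literature/NumberTheory/Irrationality/Fischler2002`; proofs-only companion of `FamilyJ.lean`, whose NAMED FACT
`integralJ_finite_iff` (the finiteness criterion for the 5-fold integrals `𝒥(p)`, in the Bochner / `IntegrableOn` form
with the unrolled `δ₁,…,δ₅` and the parameters `Params = (a, b : Fin 5 → ℤ, c : Fin 4 → ℤ)`) is DISCHARGED here as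
`integralJ_finite_iff_holds`, by transport to the general criterion `Jn_finite_iff_holds`
(`JnFinitenessCriterionProofs.lean`) at `n = 5`. Source: S. Fischler, « Formes linéaires en polyzêtas et intégrales
multiples », C. R. Acad. Sci. Paris Sér. I **335** (2002) 1–4 = arXiv:math/0202064 [Fischler2002Polyzetas], §3 p. 4;
proof in print: S. Fischler, *Groupes de Rhin-Viola et intégrales multiples*, J. Théor. Nombres Bordeaux **15** (2003)
479–534 [Fischler2003RhinViola], §4.1 Proposition 13 (cell `pub-zeta5`, seat ct-1 g32, 2026-08-27). This is the
fact consumed by `Summits/KontsevichZagierPeriods/Zeta5Search/SorokinCensus/ConvergenceCriterionProof.lean`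
(`convergenceCriterion_of_fischler`).

HONEST FRAMING (cells pub-zeta5 / zeta5-irr): systematic search; no irrationality claim unless certified. A convergence
criterion for a family of 5-fold integrals of non-negative functions; not an irrationality statement; nothing about `ζ(5)`.

## The transport
Dictionary `q = (a_k := a (k−1), b_k := b (k−1), c_k := c (k−2))` (an `Exponents` record, written inline); pointwise
`integrand p = integrandJ 5 q` (`coord`, `deltaV` unrolled to `delta1…delta5`, `Fin 5` products = `Icc 1 5` products);
`FinitenessCriterion p ↔ FinitenessCriterionGen 5 q` (the recursion `rho` unrolled); and
`IntegrableOn f [0,1]^5 ↔ ∫⁻ ofReal f < ∞` for the measurable, a.e. non-negative integrand. Theorems only, no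
definition, no new named fact (net debt −1).
-/

noncomputable section

namespace Literature.NumberTheory.Irrationality.Fischler2002

open MeasureTheory Set Finset JnChi JnFinite
open scoped ENNReal

namespace FamilyJFinite

/-! ### The dictionary at `n = 5`, unrolled -/

/-- The 1-based coordinates of `x : Fin 5 → ℝ`. [cite: Fischler2002Polyzetas, §3 p. 4 (notation x = (x₁,…,x₅))] -/
theorem coord_five (x : Fin 5 → ℝ) :
    coord x 1 = x 0 ∧ coord x 2 = x 1 ∧ coord x 3 = x 2 ∧ coord x 4 = x 3 ∧ coord x 5 = x 4 :=
  ⟨rfl, rfl, rfl, rfl, rfl⟩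

/-- The nested `δ_k` of the general family are the unrolled `delta1,…,delta5` of `FamilyJ.lean`.
[cite: Fischler2002Polyzetas, §1 p. 2 (definition of δ_k)] -/
theorem deltaV_five (x : Fin 5 → ℝ) :
    deltaV x 1 = delta1 x ∧ deltaV x 2 = delta2 x ∧ deltaV x 3 = delta3 x ∧ deltaV x 4 = delta4 x ∧
      deltaV x 5 = delta5 x := by
  obtain ⟨c1, c2, c3, c4, c5⟩ := coord_five x
  have h1 : deltaV x 1 = delta1 x := by
    change deltaV x (0 + 1) = _
    rw [deltaV, deltaV_zero, c1, delta1]; ring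
  have h2 : deltaV x 2 = delta2 x := by
    change deltaV x (1 + 1) = _
    rw [deltaV, h1, c2, delta2]
  have h3 : deltaV x 3 = delta3 x := by
    change deltaV x (2 + 1) = _
    rw [deltaV, h2, c3, delta3]
  have h4 : deltaV x 4 = delta4 x := by
    change deltaV x (3 + 1) = _
    rw [deltaV, h3, c4, delta4]
  have h5 : deltaV x 5 = delta5 x := by
    change deltaV x (4 + 1) = _
    rw [deltaV, h4, c5, delta5]
  exact ⟨h1, h2, h3, h4, h5⟩

/-- A product over `Icc 1 5` unrolled. [cite: Fischler2002Polyzetas, §3 p. 4 (produits sur k)] -/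
theorem prod_Icc_one_five {M : Type*} [CommMonoid M] (f : ℕ → M) :
    ∏ k ∈ Finset.Icc 1 5, f k = f 1 * f 2 * f 3 * f 4 * f 5 := by
  rw [Finset.prod_Icc_succ_top (by norm_num : 1 ≤ 4 + 1), Finset.prod_Icc_succ_top (by norm_num : 1 ≤ 3 + 1),
    Finset.prod_Icc_succ_top (by norm_num : 1 ≤ 2 + 1), Finset.prod_Icc_succ_top (by norm_num : 1 ≤ 1 + 1),
    Finset.Icc_self, Finset.prod_singleton]

/-- A product over `Icc 2 5` unrolled. [cite: Fischler2002Polyzetas, §3 p. 4 (produits sur k)] -/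
theorem prod_Icc_two_five {M : Type*} [CommMonoid M] (f : ℕ → M) :
    ∏ k ∈ Finset.Icc 2 5, f k = f 2 * f 3 * f 4 * f 5 := by
  rw [Finset.prod_Icc_succ_top (by norm_num : 2 ≤ 4 + 1), Finset.prod_Icc_succ_top (by norm_num : 2 ≤ 3 + 1),
    Finset.prod_Icc_succ_top (by norm_num : 2 ≤ 2 + 1), Finset.Icc_self, Finset.prod_singleton]

/-- `∀ k ∈ Icc 1 5, P k` unrolled. [cite: Fischler2002Polyzetas, §3 p. 4 (pour tout k ∈ {1,…,n})] -/
theorem forall_Icc_one_five {P : ℕ → Prop} : (∀ k ∈ Finset.Icc 1 5, P k) ↔ P 1 ∧ P 2 ∧ P 3 ∧ P 4 ∧ P 5 := by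
  constructor
  · intro h
    exact ⟨h 1 (by simp), h 2 (by simp), h 3 (by simp), h 4 (by simp), h 5 (by simp)⟩
  · rintro ⟨h1, h2, h3, h4, h5⟩ k hk
    obtain ⟨hk1, hk2⟩ := Finset.mem_Icc.1 hk
    interval_cases k <;> assumption

/-! ### The transport lemmas (for an `Exponents` record `q` reading the `Params` `p`) -/

/-- **Pointwise identity of the integrands**: if `q` reads `p` (`q.a k = a_{k−1}`, `q.b k = b_{k−1}`, `q.c k = c_{k−2}` on
the printed ranges) then `integrand p = integrandJ 5 q` everywhere. [cite: Fischler2002Polyzetas, §3 p. 4 (definition of 𝒥(p))] -/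
theorem integrand_eq_integrandJ (p : Params) (q : Exponents)
    (ha : q.a 1 = p.a 0 ∧ q.a 2 = p.a 1 ∧ q.a 3 = p.a 2 ∧ q.a 4 = p.a 3 ∧ q.a 5 = p.a 4)
    (hb : q.b 1 = p.b 0 ∧ q.b 2 = p.b 1 ∧ q.b 3 = p.b 2 ∧ q.b 4 = p.b 3 ∧ q.b 5 = p.b 4)
    (hc : q.c 2 = p.c 0 ∧ q.c 3 = p.c 1 ∧ q.c 4 = p.c 2 ∧ q.c 5 = p.c 3) (x : Fin 5 → ℝ) :
    integrand p x = integrandJ 5 q x := by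
  obtain ⟨a1, a2, a3, a4, a5⟩ := ha
  obtain ⟨b1, b2, b3, b4, b5⟩ := hb
  obtain ⟨c2, c3, c4, c5⟩ := hc
  obtain ⟨x1, x2, x3, x4, x5⟩ := coord_five x
  obtain ⟨d1, d2, d3, d4, d5⟩ := deltaV_five x
  unfold integrand integrandJ
  rw [Fin.prod_univ_five, prod_Icc_one_five, prod_Icc_two_five, x1, x2, x3, x4, x5, d2, d3, d4, d5,
    a1, a2, a3, a4, a5, b1, b2, b3, b4, b5, c2, c3, c4, c5, div_div]

/-- **The two criteria agree**: `FinitenessCriterion p ↔ FinitenessCriterionGen 5 q` (the recursion `ρ_k` unrolled: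
`ρ₅ = c₅ − b₅`, `ρ₄ = c₄ − 1 − b₄`, `ρ₃ = ρ₅⁺ + c₃ − 1 − b₃`, `ρ₂ = ρ₄⁺ + c₂ − 1 − b₂`, `ρ₁ = ρ₃⁺ − b₁`).
[cite: Fischler2002Polyzetas, §3 p. 4 (critère de finitude)] -/
theorem finitenessCriterion_iff (p : Params) (q : Exponents)
    (ha : q.a 1 = p.a 0 ∧ q.a 2 = p.a 1 ∧ q.a 3 = p.a 2 ∧ q.a 4 = p.a 3 ∧ q.a 5 = p.a 4)
    (hb : q.b 1 = p.b 0 ∧ q.b 2 = p.b 1 ∧ q.b 3 = p.b 2 ∧ q.b 4 = p.b 3 ∧ q.b 5 = p.b 4)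
    (hc : q.c 2 = p.c 0 ∧ q.c 3 = p.c 1 ∧ q.c 4 = p.c 2 ∧ q.c 5 = p.c 3) :
    FinitenessCriterion p ↔ FinitenessCriterionGen 5 q := by
  obtain ⟨a1, a2, a3, a4, a5⟩ := ha
  obtain ⟨b1, b2, b3, b4, b5⟩ := hb
  obtain ⟨c2, c3, c4, c5⟩ := hc
  -- the recursion unrolled
  have r5 : rho 5 q 5 = rho5 p := by
    rw [rho_of_le q (le_refl 5), rho_of_lt q (by norm_num), cTilde, if_neg (by norm_num), if_pos rfl, rho5, c5, b5]
    simp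
  have r4 : rho 5 q 4 = rho4 p := by
    rw [rho_of_le q (by norm_num), rho_of_lt q (by norm_num), cTilde, if_neg (by norm_num), if_neg (by norm_num),
      rho4, c4, b4]
    simp
  have r3 : rho 5 q 3 = rho3 p := by
    rw [rho_of_le q (by norm_num), show (3 : ℕ) + 2 = 5 from rfl, r5, cTilde, if_neg (by norm_num),
      if_neg (by norm_num), rho3, c3, b3]
  have r2 : rho 5 q 2 = rho2 p := by
    rw [rho_of_le q (by norm_num), show (2 : ℕ) + 2 = 4 from rfl, r4, cTilde, if_neg (by norm_num),
      if_neg (by norm_num), rho2, c2, b2]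
  have r1 : rho 5 q 1 = rho1 p := by
    rw [rho_of_le q (by norm_num), show (1 : ℕ) + 2 = 3 from rfl, r3, cTilde, if_pos rfl, rho1, b1]
  unfold FinitenessCriterion FinitenessCriterionGen
  rw [forall_Icc_one_five, forall_Icc_one_five, forall_Icc_one_five, Fin.forall_fin_succ, Fin.forall_fin_succ,
    Fin.forall_fin_succ, Fin.forall_fin_succ, Fin.forall_fin_one, Fin.forall_fin_succ, Fin.forall_fin_succ,
    Fin.forall_fin_succ, Fin.forall_fin_succ, Fin.forall_fin_one]
  simp only [Fin.succ_zero_eq_one, Fin.succ_one_eq_two, a1, a2, a3, a4, a5, b1, b2, b3, b4, b5, r1, r2, r3, r4, r5,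
    show (2 : ℕ) ≠ 1 from by norm_num, show (3 : ℕ) ≠ 1 from by norm_num, show (4 : ℕ) ≠ 1 from by norm_num,
    show (5 : ℕ) ≠ 1 from by norm_num, if_false, show 2 - 1 = 1 from rfl, show 3 - 1 = 2 from rfl,
    show 4 - 1 = 3 from rfl, show 5 - 1 = 4 from rfl]
  tauto

/-- **Integrability versus finiteness of the lower integral**: for every `q`, `integrandJ 5 q` is integrable on `[0,1]^5`
iff `𝒥(q) = Jn 5 q ≠ ∞` (the integrand is measurable and positive on the open cube, a set of full measure in the cube).
[cite: Fischler2002Polyzetas, §3 p. 4 (« finie »)] -/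
theorem integrableOn_iff_Jn_ne_top (q : Exponents) :
    IntegrableOn (integrandJ 5 q) (unitCube 5) ↔ Jn 5 q ≠ ∞ := by
  have hmeas : AEStronglyMeasurable (integrandJ 5 q) (volume.restrict (unitCube 5)) :=
    (measurable_integrandJ 5 q).aestronglyMeasurable
  have hnn : 0 ≤ᵐ[volume.restrict (unitCube 5)] integrandJ 5 q := by
    rw [← Measure.restrict_congr_set (openCube_ae_eq_unitCube 5)]
    refine (ae_restrict_iff' (measurableSet_openCube 5)).2 (Filter.Eventually.of_forall fun x hx' => ?_)
    have hx := mem_openCube_iff.1 hx'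
    rw [Pi.zero_apply, integrandJ_eq_rpow_prod (by norm_num) q hx]
    exact (phiProd_pos _ _ _ hx).le
  rw [IntegrableOn, Integrable, and_iff_right hmeas, hasFiniteIntegral_iff_ofReal hnn, Jn, lt_top_iff_ne_top]

end FamilyJFinite

open FamilyJFinite in
/-- **Fischler's finiteness criterion at `n = 5` holds** (the named fact `integralJ_finite_iff` of `FamilyJ.lean` is a
theorem): for every `p = (a, b, c) ∈ ℤ^{14}`, the integrand of `𝒥(p)` is Lebesgue-integrable on `[0,1]^5` if and only if
`a_k ≥ 0`, `b_k ≥ 0` and `ρ_k ≤ a_{k−1}` for `k = 1,…,5` (`a₀ = 0`). Transport of `Jn_finite_iff_holds` at `n = 5`.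
[cite: Fischler2002Polyzetas, §3 p. 4 (critère de finitude de 𝒥(p)), n = 5] [cite: Fischler2003RhinViola, §4.1 Proposition 13 p. 521] -/
theorem integralJ_finite_iff_holds : integralJ_finite_iff := by
  intro p
  set q : Exponents :=
    ⟨fun k => if k = 1 then p.a 0 else if k = 2 then p.a 1 else if k = 3 then p.a 2 else if k = 4 then p.a 3 else p.a 4,
      fun k => if k = 1 then p.b 0 else if k = 2 then p.b 1 else if k = 3 then p.b 2 else if k = 4 then p.b 3 else p.b 4,
      fun k => if k = 2 then p.c 0 else if k = 3 then p.c 1 else if k = 4 then p.c 2 else p.c 3⟩ with hq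
  have ha : q.a 1 = p.a 0 ∧ q.a 2 = p.a 1 ∧ q.a 3 = p.a 2 ∧ q.a 4 = p.a 3 ∧ q.a 5 = p.a 4 := by
    simp [hq]
  have hb : q.b 1 = p.b 0 ∧ q.b 2 = p.b 1 ∧ q.b 3 = p.b 2 ∧ q.b 4 = p.b 3 ∧ q.b 5 = p.b 4 := by
    simp [hq]
  have hc : q.c 2 = p.c 0 ∧ q.c 3 = p.c 1 ∧ q.c 4 = p.c 2 ∧ q.c 5 = p.c 3 := by
    simp [hq]
  have hfun : integrand p = integrandJ 5 q := funext fun x => integrand_eq_integrandJ p q ha hb hc x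
  rw [hfun, show cube = unitCube 5 from rfl, integrableOn_iff_Jn_ne_top, finitenessCriterion_iff p q ha hb hc]
  exact Jn_finite_iff_holds 5 q (by norm_num)

end Literature.NumberTheory.Irrationality.Fischler2002

end
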